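import Literature.AlgebraicGeometry.Motives.KunnethProjectorsDirectSummand
import Literature.AlgebraicGeometry.Motives.ChowCorrespondences
import HarnessLib

/-!
# The push-forward of a Weil cohomology theory: projection formula, functoriality, degree, and
`f₊` as an algebraic correspondence in every degree (Kahn 2020 §3.5.1; Kleiman 1968 §1.3)

For a Weil cohomology theory `W` (the tree's `WeilCohomology k K`, Kleiman's axioms) and a
morphism `f : V ⟶ U` of smooth projective varieties of dimensions `N`, `M`, the tree *defines* the
push-forward `f₊ : Hᵉ(V) → Hᵈ(U)` (`e + d' = 2N`, `d + d' = 2M`) as the Poincaré-duality adjoint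
of `f* : H^{d'}(U) → H^{d'}(V)` (`WeilCohomology.pushforward`, `trace_cup_pushforward`; Kahn 2020
§3.5.1 "We define `f_*` … as the dual of `f^*` via Poincaré duality"). This file proves the
formal properties printed in Kahn 2020 §3.5.1 and Example 3.47, and Kleiman 1968 §1.3:

* `trace_pullback_cup_eq` — the adjunction with the factors exchanged,
  `tr_V (f* β ∪ μ) = tr_U (β ∪ f₊ μ)` (the two Koszul signs agree);
* `isInducedBy_pushforward`, `exists_isInducedBy_pushforward` — **`f₊` is induced, in every
  degree, by one rational algebraic class**, the transpose `σ* γ ∈ Aᴹ(V × U)_ℚ` of a class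
  `γ ∈ Aᴹ(U × V)_ℚ` inducing `f*` (Kahn Example 3.47: "Its transpose is (by definition) `f_*`";
  Kleiman §1.3; the tree's transpose lemma `isInducedBy_transposeClass_of_adjoint`, previously
  applied to `f₊` only in even degrees), whence the degreewise graded operator `f₊` is an
  algebraic graded correspondence `H•(V) → H•(U)` (`exists_isAlgebraicGradedOp_pushforward`, via
  `isAlgebraicGradedOp_corrOp`: the graded operator `u_*` of any rational algebraic class is
  algebraic);
* `pushforward_cup_pullback`, `pushforward_pullback_cup` — the **projection formula**
  `f₊ (α ∪ f* β) = f₊ α ∪ β` (Kahn §3.5.1, with its printed proof by adjunction);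
* `pushforward_id`, `pushforward_comp`, `trace_pushforward` — `(𝟙)₊ = id`, `(f ≫ g)₊ = g₊ ∘ f₊`,
  `Tr_U ∘ f₊ = Tr_V` (Kahn Example 3.47 and (3.5.5));
* the **degree** of an equidimensional `f` (`N = M`): `A⁰(U)_ℚ = ℚ · 1`
  (`exists_eq_ratCast_smul_one_of_mem_ratAlgebraicClasses_zero`), so `f₊ 1 = q · 1` with `q ∈ ℚ`
  (`exists_pushforward_one_eq_ratCast_smul`), `f₊ f* = q · id` on every `Hⁱ(U)`
  (`pushforward_pullback_eq_smul`), `tr_V ∘ f* = q · tr_U` (`trace_pullback_eq_mul`), and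
  `q ≠ 0 ⇔ f* ≠ 0` on `H²ᴺ(U)` (`pushforward_one_eq_zero_iff`), in which case `f*` is injective
  in every degree (`pullback_injective_of_pullback_top_ne_zero`; Kleiman 1968 Prop. 1.2.4 for
  `f` surjective);
* **`C` descends along morphisms of non-zero degree**: if `f* ≠ 0` on `H²ᴺ(U)` then `h(U)` is a
  retract of `h(V)` through the algebraic correspondences `f*` and `q⁻¹ f₊`, so `πⁱ_V` algebraic
  implies `πⁱ_U` algebraic and `C(V) ⇒ C(U)` (`isAlgebraicOperator_id_of_pullback_top_ne_zero`,
  `standardConjectureC_of_pullback_top_ne_zero`; Kahn 2020 Lemma 6.30 (2) via the tree's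
  `isAlgebraicOperator_id_of_retract`).

Theorems only; no new definitions, no named facts.

## References

* [Kahn2020] B. Kahn, *Zeta and L-functions of varieties and motives*, LMS Lecture Note Series 462
  (2020), §3.5.1 (direct image, projection formula), Example 3.47, formula (3.5.5), Lemma 3.48,
  §6.9 Lemma 6.30 (2).
* [Kleiman1968AlgebraicCycles] S. Kleiman, *Algebraic cycles and the Weil conjectures*, in: Dix
  exposés sur la cohomologie des schémas (1968), §1.2 (Prop. 1.2.4), §1.3.
-/

universe u v

open CategoryTheory AlgebraicGeometry MonoidalCategory CartesianMonoidalCategory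

noncomputable section

namespace Literature.AlgebraicGeometry.Motives

namespace WeilCohomology

variable {k : Type u} [Field k] {K : Type v} [Field K] [CharZero K] (W : WeilCohomology k K)

/-! ## The graded operator of a rational algebraic class is algebraic -/

section CorrOp

variable {nY : ℕ} {X Y : SchemeOver k}

/-- **The graded operator `u_*` of a rational algebraic class `u ∈ Aᶜ(X × Y)_ℚ` is an algebraic
graded correspondence** (Kleiman 1968 §1.3–1.4: induced on the bidegrees `2c + i = j + 2 dim X` by
`u`, zero elsewhere; the tree's `isAlgebraicGradedOp_realize` is the case `u = γ_ℚ(f)`).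
[cite: Kleiman1968AlgebraicCycles, §1.3 and §1.4] -/
theorem isAlgebraicGradedOp_corrOp (hY : IsSmoothProjective nY Y) {nX c : ℕ}
    {u : W.obj (X ⊗ Y) (2 * c)} (hu : u ∈ W.ratAlgebraicClasses (X ⊗ Y) c) :
    W.IsAlgebraicGradedOp nX nY (W.corrOp hY nX c u) := by
  classical
  refine ⟨Pi.single c ⟨u, hu⟩, ?_, ?_⟩
  · intro i j c' j' hj hm hline
    by_cases hc : c' = c
    · subst hc
      rw [Pi.single_eq_same]
      exact W.isInducedBy_corrOp hY hline hj hm u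
    · rw [W.corrOp_apply_of_not hY (fun h ↦ hc (by omega)) u, Pi.single_eq_of_ne hc,
        AddSubgroup.coe_zero]
      exact W.isInducedBy_zero
  · intro i j hij
    exact W.corrOp_apply_of_not hY (fun h ↦ hij ⟨c, h.1⟩) u

/-- `u_*` is *the* operator induced by `u`: if `u` induces `T : Hⁱ(X) → Hʲ(Y)` on a bidegree
`2c + i = j + 2 dim X`, then `(u_*)ᵢⱼ = T` (operators are determined by a class inducing them,
`eq_of_isInducedBy_of_isInducedBy`). [cite: Kleiman1968AlgebraicCycles, §1.3] -/
theorem corrOp_eq_of_isInducedBy (hY : IsSmoothProjective nY Y) {nX c i j j' : ℕ}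
    {u : W.obj (X ⊗ Y) (2 * c)} {T : W.obj X i →ₗ[K] W.obj Y j} (h : 2 * c + i = j + 2 * nX)
    {hj : j + j' = 2 * nY} {hm : i + 2 * c + j' = 2 * (nX + nY)}
    (hT : W.IsInducedBy nX nY u T hj hm) : W.corrOp hY nX c u i j = T :=
  W.eq_of_isInducedBy_of_isInducedBy hY (W.isInducedBy_corrOp hY h hj hm u) hT

end CorrOp

/-! ## The adjunction in all degrees; `f₊` is induced by the transposed graph class -/

section Adjunction

variable {N M : ℕ} {V U : SchemeOver k}

/-- The adjunction defining `f₊` with the factors exchanged: `tr_V (f* β ∪ μ) = tr_U (β ∪ f₊ μ)`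
for `β ∈ H^{d'}(U)`, `μ ∈ Hᵉ(V)` (`e + d' = 2N`, `d + d' = 2M`). From `tr_U (f₊ μ ∪ β) =
tr_V (μ ∪ f* β)` (`trace_cup_pushforward`) and graded commutativity: the signs `(-1)^{d'e}` and
`(-1)^{d'd}` agree since `e ≡ d (mod 2)` (Kahn 2020 §3.5.1, "`f_*` is adjoint to `f^*` for the
Poincaré pairing"). [cite: Kahn2020, §3.5.1] -/
theorem trace_pullback_cup_eq (hV : IsSmoothProjective N V) (hU : IsSmoothProjective M U)
    (f : V ⟶ U) {e d d' : ℕ} (he : e + d' = 2 * N) (hd : d + d' = 2 * M)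
    (he' : d' + e = 2 * N) (hd' : d' + d = 2 * M) (β : W.obj U d') (μ : W.obj V e) :
    W.trace V N (W.cup he' (W.pullback f d' β) μ) =
      W.trace U M (W.cup hd' β (W.pushforward (N := N) hU f he hd μ)) := by
  have hsign : ((d' : ℤ) * e).negOnePow = ((d' : ℤ) * d).negOnePow := by
    refine negOnePow_congr ⟨(d' : ℤ) * ((N : ℤ) - M), ?_⟩
    have h1 : (e : ℤ) = 2 * N - d' := by omega
    have h2 : (d : ℤ) = 2 * M - d' := by omega
    rw [h1, h2]
    ring
  rw [W.trace_cup_comm hV he' he, W.trace_cup_comm hU hd' hd, W.trace_cup_pushforward, hsign]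

/-- **`f₊` is induced by the transpose of a class inducing `f*`, in every degree** (Kahn 2020
Example 3.47: the transpose of the cohomological correspondence `f^*` "is (by definition) `f_*`";
Lemma 3.48 `ᵗφ = σ* φ`; Kleiman 1968 §1.3): if `γ ∈ H^{2M}(U × V)` induces
`f* : H^{d'}(U) → H^{d'}(V)`, then `σ* γ ∈ H^{2M}(V × U)` induces `f₊ : Hᵉ(V) → Hᵈ(U)`
(`e + d' = 2N`, `d + d' = 2M`). The tree's transpose lemma `isInducedBy_transposeClass_of_adjoint`
with the exchanged adjunction `trace_pullback_cup_eq`; no parity restriction on `e`.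
[cite: Kahn2020, §3.5.3 Example 3.47 and Lemma 3.48] [cite: Kleiman1968AlgebraicCycles, §1.3] -/
theorem isInducedBy_pushforward (hV : IsSmoothProjective N V) (hU : IsSmoothProjective M U)
    (f : V ⟶ U) {γ : W.obj (U ⊗ V) (2 * M)} {e d d' : ℕ} (he : e + d' = 2 * N)
    (hd : d + d' = 2 * M) {he' : d' + e = 2 * N} {hm' : d' + 2 * M + e = 2 * (M + N)}
    (hγ : W.IsInducedBy M N γ (W.pullback f d') he' hm') :
    W.IsInducedBy N M (W.transposeClass γ) (W.pushforward (N := N) hU f he hd) hd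
      (show e + 2 * M + d' = 2 * (N + M) by omega) := by
  refine W.isInducedBy_transposeClass_of_adjoint hU hV hγ (by omega : d' + d = 2 * M) ?_ hd _
  intro β μ
  rw [W.cupPairing_apply, W.cupPairing_apply]
  exact W.trace_pullback_cup_eq hV hU f he hd he' _ β μ

/-- **One rational algebraic class induces `f₊` in all degrees**: for `f : V ⟶ U` between smooth
projective varieties (dimensions `N`, `M`) there is `u ∈ Aᴹ(V × U)_ℚ` — the transpose of the
class of the transposed graph given by the axiom `exists_isInducedBy_pullback`, i.e. the class of
the graph `Γ_f` — inducing `f₊ : Hᵉ(V) → Hᵈ(U)` for all `e + d' = 2N`, `d + d' = 2M`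
(Kahn 2020 Example 3.47; Kleiman 1968 §1.3; Fulton Prop. 16.1.2 (c) `(Γ_f)_* = f_*`).
[cite: Kahn2020, §3.5.3 Example 3.47] [cite: Kleiman1968AlgebraicCycles, §1.3] -/
theorem exists_isInducedBy_pushforward (hV : IsSmoothProjective N V) (hU : IsSmoothProjective M U)
    (f : V ⟶ U) :
    ∃ u ∈ W.ratAlgebraicClasses (V ⊗ U) M,
      ∀ (e d d' : ℕ) (he : e + d' = 2 * N) (hd : d + d' = 2 * M),
        W.IsInducedBy N M u (W.pushforward (N := N) hU f he hd) hd
          (show e + 2 * M + d' = 2 * (N + M) by omega) := by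
  obtain ⟨γ, hγ, hγi⟩ := W.exists_isInducedBy_pullback hV hU f
  refine ⟨W.transposeClass γ, W.pullback_ratAlgebraicClasses_le (IsSmoothProjective.tensor_holds hV hU)
      (IsSmoothProjective.tensor_holds hU hV) (β_ V U).hom M ⟨γ, hγ, rfl⟩, fun e d d' he hd ↦ ?_⟩
  exact W.isInducedBy_pushforward hV hU f he hd (hγi d' e (by omega))

/-- **The degreewise push-forward is an algebraic graded correspondence `H•(V) → H•(U)`**: there is
a graded operator `P` with components `P e d = f₊ : Hᵉ(V) → Hᵈ(U)` on the bidegrees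
`2M + e = d + 2N` (`d ≤ 2M`) and `0` elsewhere, induced in codimension `M` by one rational
algebraic class (Kleiman 1968 §1.3: `f_*` is the algebraic correspondence `Γ_f`; Kahn 2020
Example 3.47). Concretely `P = u_*` for the class `u` of `exists_isInducedBy_pushforward`.
[cite: Kleiman1968AlgebraicCycles, §1.3] [cite: Kahn2020, §3.5.3 Example 3.47] -/
theorem exists_isAlgebraicGradedOp_pushforward (hV : IsSmoothProjective N V)
    (hU : IsSmoothProjective M U) (f : V ⟶ U) :
    ∃ P : W.GradedOp V U, W.IsAlgebraicGradedOp N M P ∧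
      (∀ (e d d' : ℕ) (he : e + d' = 2 * N) (hd : d + d' = 2 * M),
        P e d = W.pushforward (N := N) hU f he hd) ∧
      ∀ e d : ℕ, ¬ (2 * M + e = d + 2 * N ∧ d ≤ 2 * M) → P e d = 0 := by
  obtain ⟨u, hu, hui⟩ := W.exists_isInducedBy_pushforward hV hU f
  exact ⟨W.corrOp hU N M u, W.isAlgebraicGradedOp_corrOp hU hu,
    fun e d d' he hd ↦ W.corrOp_eq_of_isInducedBy hU (by omega) (hui e d d' he hd),
    fun e d h ↦ W.corrOp_apply_of_not hU h u⟩

end Adjunction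

/-! ## The projection formula (Kahn 2020 §3.5.1) -/

section ProjectionFormula

variable {N M : ℕ} {V U : SchemeOver k}

/-- **Projection formula** `f₊ (α ∪ f* β) = f₊ α ∪ β` (Kahn 2020 §3.5.1, with the printed proof:
for `z` of complementary degree, `⟨f₊(α ∪ f*β), z⟩_U = ⟨α ∪ f*β, f*z⟩_V = ⟨α, f*(β ∪ z)⟩_V =
⟨f₊ α, β ∪ z⟩_U = ⟨f₊ α ∪ β, z⟩_U`, and the Poincaré pairing of `U` is perfect). Degrees:
`α ∈ Hᵃ(V)`, `β ∈ Hᵇ(U)`, `a + b = s`, `s + d' = 2N`, `d + d' = 2M` (for `f₊ (α ∪ f*β) ∈ Hᵈ(U)`),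
`a + d₁' = 2N`, `d₁ + d₁' = 2M` (for `f₊ α ∈ H^{d₁}(U)`), `d₁ + b = d`. [cite: Kahn2020, §3.5.1 (projection formula)] -/
theorem pushforward_cup_pullback (hV : IsSmoothProjective N V) (hU : IsSmoothProjective M U)
    (f : V ⟶ U) {a b s d d' d₁ d₁' : ℕ} (hs : a + b = s) (he : s + d' = 2 * N)
    (hd : d + d' = 2 * M) (he₁ : a + d₁' = 2 * N) (hd₁ : d₁ + d₁' = 2 * M) (hd₂ : d₁ + b = d)
    (α : W.obj V a) (β : W.obj U b) :
    W.pushforward (N := N) hU f he hd (W.cup hs α (W.pullback f b β)) =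
      W.cup hd₂ (W.pushforward (N := N) hU f he₁ hd₁ α) β := by
  refine (W.pdEquiv hU hd).injective (LinearMap.ext fun z ↦ ?_)
  have hbd : b + d' = d₁' := by omega
  rw [W.pdEquiv_apply, W.pdEquiv_apply, W.trace_cup_pushforward,
    W.cup_assoc hV hs hbd he he₁ α (W.pullback f b β) (W.pullback f d' z),
    ← W.map_cup hV hU f hbd β z, ← W.trace_cup_pushforward (N := N) hU f he₁ hd₁,
    W.cup_assoc hU hd₂ hbd hd hd₁]

/-- **Projection formula, pulled-back class on the left**: `f₊ (f* β ∪ α) = β ∪ f₊ α`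
(Kahn 2020 §3.5.1; from `pushforward_cup_pullback` by graded commutativity — the signs
`(-1)^{ba}` and `(-1)^{b d₁}` agree because `a ≡ d₁ (mod 2)`). Degrees: `β ∈ Hᵇ(U)`,
`α ∈ Hᵃ(V)`, `b + a = s`, `s + d' = 2N`, `d + d' = 2M`, `a + d₁' = 2N`, `d₁ + d₁' = 2M`,
`b + d₁ = d`. [cite: Kahn2020, §3.5.1 (projection formula)] -/
theorem pushforward_pullback_cup (hV : IsSmoothProjective N V) (hU : IsSmoothProjective M U)
    (f : V ⟶ U) {a b s d d' d₁ d₁' : ℕ} (hs : b + a = s) (he : s + d' = 2 * N)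
    (hd : d + d' = 2 * M) (he₁ : a + d₁' = 2 * N) (hd₁ : d₁ + d₁' = 2 * M) (hd₂ : b + d₁ = d)
    (β : W.obj U b) (α : W.obj V a) :
    W.pushforward (N := N) hU f he hd (W.cup hs (W.pullback f b β) α) =
      W.cup hd₂ β (W.pushforward (N := N) hU f he₁ hd₁ α) := by
  have hs' : a + b = s := by omega
  have hd₂' : d₁ + b = d := by omega
  have hpar : Even ((b : ℤ) * a + (d₁ : ℤ) * b) := by
    rw [show (b : ℤ) * a + (d₁ : ℤ) * b = b * (a + d₁) by ring]
    exact Int.even_mul.mpr (Or.inr ⟨(N : ℤ) + M - d₁', by omega⟩)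
  rw [W.cup_comm hV hs hs', map_zsmul, W.pushforward_cup_pullback hV hU f hs' he hd he₁ hd₁ hd₂',
    W.cup_comm hU hd₂' hd₂, smul_smul, ← Units.val_mul, ← Int.negOnePow_add,
    Int.negOnePow_even _ hpar, Units.val_one, one_smul]

end ProjectionFormula

/-! ## Functoriality and the trace (Kahn 2020 Example 3.47, (3.5.5)) -/

section Functoriality

variable {N M L : ℕ} {V U Z : SchemeOver k}

/-- `(𝟙_V)₊ = id` on `Hᵉ(V)` (the adjoint of `(𝟙_V)* = id`; Kahn 2020 Example 3.47).
[cite: Kahn2020, §3.5.3 Example 3.47] -/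
theorem pushforward_id (hV : IsSmoothProjective N V) {e d' : ℕ} (he : e + d' = 2 * N) :
    W.pushforward (N := N) hV (𝟙 V) he he = LinearMap.id := by
  refine LinearMap.ext fun α ↦ (W.pdEquiv hV he).injective (LinearMap.ext fun z ↦ ?_)
  rw [W.pdEquiv_apply, W.pdEquiv_apply, W.trace_cup_pushforward, W.pullback_id,
    LinearMap.id_apply, LinearMap.id_apply]

/-- **`(f ≫ g)₊ = g₊ ∘ f₊`** for `f : V ⟶ U`, `g : U ⟶ Z` (`U`, `Z` smooth projective of
dimensions `M`, `L`; all three push-forwards share the complementary degree `c`: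
`e + c = 2N`, `d + c = 2M`, `d₂ + c = 2L`) (Kahn 2020 Example 3.47, "`(g ∘ f)_* = g_* ∘ f_*`";
from `(f ≫ g)* = f* ∘ g*`). [cite: Kahn2020, §3.5.3 Example 3.47] -/
theorem pushforward_comp (hU : IsSmoothProjective M U) (hZ : IsSmoothProjective L Z) (f : V ⟶ U)
    (g : U ⟶ Z) {e d d₂ c : ℕ} (he : e + c = 2 * N) (hd : d + c = 2 * M) (hd₂ : d₂ + c = 2 * L) :
    W.pushforward (N := N) hZ (f ≫ g) he hd₂ =
      W.pushforward (N := M) hZ g hd hd₂ ∘ₗ W.pushforward (N := N) hU f he hd := by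
  refine LinearMap.ext fun α ↦ (W.pdEquiv hZ hd₂).injective (LinearMap.ext fun z ↦ ?_)
  rw [W.pdEquiv_apply, W.pdEquiv_apply, W.trace_cup_pushforward, LinearMap.comp_apply,
    W.trace_cup_pushforward, W.trace_cup_pushforward, W.pullback_comp, LinearMap.comp_apply]

/-- **`Tr_U ∘ f₊ = Tr_V`** on top-degree classes (Kahn 2020 (3.5.5), `Tr_X = Tr_Y ∘ f_*`):
`tr_U (f₊ α) = tr_U (f₊ α ∪ 1) = tr_V (α ∪ f* 1) = tr_V α` (`map_one`). [cite: Kahn2020, §3.5.3 formula (3.5.5)] -/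
theorem trace_pushforward (hV : IsSmoothProjective N V) (hU : IsSmoothProjective M U) (f : V ⟶ U)
    (he : 2 * N + 0 = 2 * N) (hd : 2 * M + 0 = 2 * M) (α : W.obj V (2 * N)) :
    W.trace U M (W.pushforward (N := N) hU f he hd α) = W.trace V N α := by
  rw [← W.cup_one hU hd (W.pushforward (N := N) hU f he hd α), W.trace_cup_pushforward,
    W.map_one hV hU f, W.cup_one hV he]

end Functoriality

/-! ## `A⁰(X)_ℚ = ℚ · 1` -/

section DegreeZero

variable {n : ℕ} {X : SchemeOver k}

/-- The algebraic lattice in codimension `0` is `ℤ · 1`: it is generated by the classes of the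
codimension-`0` points, each of which is the class of `X`, i.e. `1` (axiom
`cycleClass_of_coheight_eq_zero`, Kleiman 1968 §1.2 (C) `γ_X[X] = 1`). [cite: Kleiman1968AlgebraicCycles, §1.2 (C)] -/
theorem exists_eq_zsmul_one_of_mem_algebraicLattice_zero (hX : IsSmoothProjective n X)
    {x : W.obj X (2 * 0)} (hx : x ∈ W.algebraicLattice X 0) : ∃ m : ℤ, x = m • W.one X := by
  induction hx using AddSubgroup.closure_induction with
  | mem y hy =>
    obtain ⟨⟨z, hz⟩, rfl⟩ := hy
    exact ⟨1, by rw [one_zsmul]; exact W.cycleClass_of_coheight_eq_zero hX z hz⟩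
  | zero => exact ⟨0, by rw [zero_zsmul]⟩
  | add a b _ _ ha hb =>
    obtain ⟨m, rfl⟩ := ha
    obtain ⟨m', rfl⟩ := hb
    exact ⟨m + m', by rw [add_zsmul]⟩
  | neg a _ ha =>
    obtain ⟨m, rfl⟩ := ha
    exact ⟨-m, by rw [neg_zsmul]⟩

/-- **`A⁰(X)_ℚ = ℚ · 1`**: every rational algebraic class of codimension `0` on a smooth
projective `X` is a rational multiple of the unit (Kleiman 1968 §1.2 (C), `γ_X[X] = 1`).
[cite: Kleiman1968AlgebraicCycles, §1.2 (C)] -/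
theorem exists_eq_ratCast_smul_one_of_mem_ratAlgebraicClasses_zero (hX : IsSmoothProjective n X)
    {x : W.obj X (2 * 0)} (hx : x ∈ W.ratAlgebraicClasses X 0) :
    ∃ q : ℚ, x = (q : K) • W.one X := by
  obtain ⟨N, hN, hNx⟩ := hx
  obtain ⟨m, hm⟩ := W.exists_eq_zsmul_one_of_mem_algebraicLattice_zero hX hNx
  have hNK : (N : K) ≠ 0 := Int.cast_ne_zero.mpr hN
  have h1 : (N : K) • x = (m : K) • W.one X := by
    rw [Int.cast_smul_eq_zsmul, hm, Int.cast_smul_eq_zsmul]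
  refine ⟨m / N, ?_⟩
  rw [Rat.cast_div, Rat.cast_intCast, Rat.cast_intCast, div_eq_inv_mul, mul_smul, ← h1, smul_smul,
    inv_mul_cancel₀ hNK, one_smul]

end DegreeZero

/-! ## The degree of an equidimensional morphism -/

section Degree

variable {N : ℕ} {V U : SchemeOver k}

/-- **The degree is rational**: for `f : V ⟶ U` between smooth projective varieties of the same
dimension `N`, `f₊ 1 ∈ A⁰(U)_ℚ` (push-forward preserves rational algebraic classes,
`pushforward_mem_ratAlgebraicClasses`) is `q · 1` for some `q ∈ ℚ` — the degree of `f`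
(Kahn 2020 §3.5.1; for curves Exercise 2.23 (b), `f_* ∘ f^* = deg(f) Δ`).
[cite: Kahn2020, §3.5.1] [cite: Kleiman1968AlgebraicCycles, §1.3] -/
theorem exists_pushforward_one_eq_ratCast_smul (hV : IsSmoothProjective N V)
    (hU : IsSmoothProjective N U) (f : V ⟶ U) (h0 : 0 + 2 * N = 2 * N) :
    ∃ q : ℚ, W.pushforward (N := N) hU f h0 h0 (W.one V) = (q : K) • W.one U := by
  have hmem : W.pushforward (N := N) hU f h0 h0 (W.one V) ∈ W.ratAlgebraicClasses U 0 :=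
    W.pushforward_mem_ratAlgebraicClasses hV hU f (a := 0) (b := 0) h0 h0
      (W.one_mem_ratAlgebraicClasses hV)
  exact W.exists_eq_ratCast_smul_one_of_mem_ratAlgebraicClasses_zero hU hmem

/-- **`f₊ f* = deg(f) · id`** on every `Hⁱ(U)` for `f : V ⟶ U` equidimensional with `f₊ 1 = q · 1`:
`f₊ (f* β) = f₊ (1 ∪ f* β) = f₊ 1 ∪ β = q · β` (projection formula; Kahn 2020 §3.5.1, and
Exercise 2.23 (b) for curves). [cite: Kahn2020, §3.5.1] -/
theorem pushforward_pullback_eq_smul (hV : IsSmoothProjective N V) (hU : IsSmoothProjective N U)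
    (f : V ⟶ U) (h0 : 0 + 2 * N = 2 * N) {q : ℚ}
    (hq : W.pushforward (N := N) hU f h0 h0 (W.one V) = (q : K) • W.one U) {i i' : ℕ}
    (hi : i + i' = 2 * N) (β : W.obj U i) :
    W.pushforward (N := N) hU f hi hi (W.pullback f i β) = (q : K) • β := by
  have h := W.pushforward_cup_pullback hV hU f (Nat.zero_add i) hi hi h0 h0 (Nat.zero_add i)
    (W.one V) β
  rwa [W.one_cup hV (Nat.zero_add i) (W.pullback f i β), hq, LinearMap.map_smul₂,
    W.one_cup hU (Nat.zero_add i)] at h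

/-- **`tr_V ∘ f* = deg(f) · tr_U`**: for `ω ∈ H²ᴺ(U)`, `tr_V (f* ω) = tr_V (1 ∪ f* ω) =
tr_U (f₊ 1 ∪ ω) = q · tr_U ω` (Kahn 2020 §3.5.1, the adjunction, with (3.5.5)). [cite: Kahn2020, §3.5.1] -/
theorem trace_pullback_eq_mul (hV : IsSmoothProjective N V) (hU : IsSmoothProjective N U)
    (f : V ⟶ U) (h0 : 0 + 2 * N = 2 * N) {q : ℚ}
    (hq : W.pushforward (N := N) hU f h0 h0 (W.one V) = (q : K) • W.one U)
    (ω : W.obj U (2 * N)) :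
    W.trace V N (W.pullback f (2 * N) ω) = (q : K) * W.trace U N ω := by
  have h := W.trace_cup_pushforward (N := N) hU f h0 h0 (W.one V) ω
  rw [hq, W.one_cup hV h0, LinearMap.map_smul₂, map_smul, W.one_cup hU h0, smul_eq_mul] at h
  exact h.symm

/-- **`deg(f) = 0 ⇔ f* = 0` on `H²ᴺ(U)`**: `f₊ 1 = 0` iff the pull-back in top degree vanishes
(`tr_V ∘ f* = q · tr_U` with `tr_U`, `tr_V` isomorphisms and `1 ≠ 0`). [cite: Kahn2020, §3.5.1] -/
theorem pushforward_one_eq_zero_iff (hV : IsSmoothProjective N V) (hU : IsSmoothProjective N U)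
    (f : V ⟶ U) (h0 : 0 + 2 * N = 2 * N) :
    W.pushforward (N := N) hU f h0 h0 (W.one V) = 0 ↔ W.pullback f (2 * N) = 0 := by
  obtain ⟨q, hq⟩ := W.exists_pushforward_one_eq_ratCast_smul hV hU f h0
  constructor
  · intro h
    have hq1 : (q : K) • W.one U = 0 := by rw [← hq]; exact h
    have hq0 : (q : K) = 0 := (smul_eq_zero.mp hq1).resolve_right (W.unit_ne_zero hU)
    refine LinearMap.ext fun ω ↦ (W.bijective_trace hV).1 ?_
    rw [W.trace_pullback_eq_mul hV hU f h0 hq, hq0, zero_mul, LinearMap.zero_apply, map_zero]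
  · intro h
    obtain ⟨ω, hω⟩ := (W.bijective_trace hU).2 1
    have h1 := W.trace_pullback_eq_mul hV hU f h0 hq ω
    rw [h, LinearMap.zero_apply, map_zero, hω, mul_one] at h1
    rw [hq, ← h1, zero_smul]

/-- **`f*` is injective in every degree when `deg(f) ≠ 0`**, i.e. when `f* ≠ 0` on `H²ᴺ(U)`:
`f₊ f* = q · id` with `q ≠ 0` (Kleiman 1968 Prop. 1.2.4 for `f` surjective and generically
finite; Kahn 2020 §3.5.1). [cite: Kleiman1968AlgebraicCycles, §1.2 Prop. 1.2.4] [cite: Kahn2020, §3.5.1] -/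
theorem pullback_injective_of_pullback_top_ne_zero (hV : IsSmoothProjective N V)
    (hU : IsSmoothProjective N U) (f : V ⟶ U) (hf : W.pullback f (2 * N) ≠ 0) (i : ℕ) :
    Function.Injective (W.pullback f i) := by
  have h0 : 0 + 2 * N = 2 * N := Nat.zero_add _
  obtain ⟨q, hq⟩ := W.exists_pushforward_one_eq_ratCast_smul hV hU f h0
  have hq0 : (q : K) ≠ 0 := fun h ↦
    hf ((W.pushforward_one_eq_zero_iff hV hU f h0).mp (by rw [hq, h, zero_smul]))
  by_cases hi : i ≤ 2 * N
  · intro β β' h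
    have h' := congrArg (W.pushforward (N := N) hU f (e := i) (d := i) (d' := 2 * N - i)
      (by omega) (by omega)) h
    rwa [W.pushforward_pullback_eq_smul hV hU f h0 hq (by omega),
      W.pushforward_pullback_eq_smul hV hU f h0 hq (by omega), smul_right_inj hq0] at h'
  · haveI := W.subsingleton_obj hU (i := i) (by omega)
    exact fun a b _ ↦ Subsingleton.elim a b

/-- **Betti numbers do not decrease under morphisms of non-zero degree**:
`dim Hⁱ(U) ≤ dim Hⁱ(V)` for `f : V ⟶ U` equidimensional with `f* ≠ 0` on `H²ᴺ(U)`
(`f*` injective, Kleiman 1968 Prop. 1.2.4). [cite: Kleiman1968AlgebraicCycles, §1.2 Prop. 1.2.4] -/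
theorem finrank_le_of_pullback_top_ne_zero (hV : IsSmoothProjective N V)
    (hU : IsSmoothProjective N U) (f : V ⟶ U) (hf : W.pullback f (2 * N) ≠ 0) (i : ℕ) :
    Module.finrank K (W.obj U i) ≤ Module.finrank K (W.obj V i) := by
  haveI := W.finite_obj hV i
  exact LinearMap.finrank_le_finrank_of_injective
    (W.pullback_injective_of_pullback_top_ne_zero hV hU f hf i)

end Degree

/-! ## `C` descends along morphisms of non-zero degree (Kahn 2020 Lemma 6.30 (2)) -/

section Descent

variable {N : ℕ} {V U : SchemeOver k}

/-- **`πⁱ_V` algebraic ⇒ `πⁱ_U` algebraic along `f : V ⟶ U` of non-zero degree**: for `V`, `U`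
smooth projective of the same dimension `N` and `f* ≠ 0` on `H²ᴺ(U)` (so `f₊ 1 = q · 1`,
`q ∈ ℚˣ`), the algebraic graded correspondences `A = f* : H•(U) → H•(V)` and
`B = q⁻¹ f₊ : H•(V) → H•(U)` satisfy `B ∘ A = id` degreewise (`pushforward_pullback_eq_smul`), so
`h(U)` is a direct summand of `h(V)` and Kahn's Lemma 6.30 (2) applies
(`isAlgebraicOperator_id_of_retract`). [cite: Kahn2020, §6.9 Lemma 6.30 (2)] [cite: Kleiman1968AlgebraicCycles, §1.3] -/
theorem isAlgebraicOperator_id_of_pullback_top_ne_zero (hV : IsSmoothProjective N V)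
    (hU : IsSmoothProjective N U) (f : V ⟶ U) (hf : W.pullback f (2 * N) ≠ 0) {i : ℕ}
    (hi : W.IsAlgebraicOperator N N (LinearMap.id : W.obj V i →ₗ[K] W.obj V i)) :
    W.IsAlgebraicOperator N N (LinearMap.id : W.obj U i →ₗ[K] W.obj U i) := by
  have h0 : 0 + 2 * N = 2 * N := Nat.zero_add _
  obtain ⟨q, hq⟩ := W.exists_pushforward_one_eq_ratCast_smul hV hU f h0
  have hq0 : (q : K) ≠ 0 := fun h ↦
    hf ((W.pushforward_one_eq_zero_iff hV hU f h0).mp (by rw [hq, h, zero_smul]))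
  obtain ⟨P, hPalg, hP, hP0⟩ := W.exists_isAlgebraicGradedOp_pushforward hV hU f
  refine W.isAlgebraicOperator_id_of_retract hU hV
    (A := fun a b ↦ PreWeilCohomology.GradedOp.ofLinearMap (W.pullback f a) a b)
    (B := ((q⁻¹ : ℚ) : K) • P)
    (W.isAlgebraicGradedOp_degreewise_pullback hV hU f) (hPalg.ratCast_smul q⁻¹)
    (fun a b hab ↦ PreWeilCohomology.GradedOp.degreewise_apply_of_ne _ hab)
    (fun a b hab ↦ ?_) ?_ hi
  · rw [Pi.smul_apply, Pi.smul_apply, hP0 a b (fun h ↦ hab (by obtain ⟨h1, -⟩ := h; omega)),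
      smul_zero]
  · rw [PreWeilCohomology.GradedOp.ofLinearMap_apply_same, Pi.smul_apply, Pi.smul_apply]
    by_cases hi2 : i ≤ 2 * N
    · rw [hP i i (2 * N - i) (by omega) (by omega), LinearMap.smul_comp]
      refine LinearMap.ext fun β ↦ ?_
      rw [LinearMap.smul_apply, LinearMap.comp_apply,
        W.pushforward_pullback_eq_smul hV hU f h0 hq (by omega) β, smul_smul, Rat.cast_inv,
        inv_mul_cancel₀ hq0, one_smul, LinearMap.id_apply]
    · haveI := W.subsingleton_obj hU (i := i) (by omega)
      exact LinearMap.ext fun β ↦ Subsingleton.elim _ _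

/-- **`C(V) ⇒ C(U)` along a morphism `f : V ⟶ U` of non-zero degree** (`V`, `U` smooth projective
of the same dimension, `f* ≠ 0` on `H²ᴺ(U)` — e.g. `f` surjective and generically finite for the
classical theories): `h(U)` is a direct summand of `h(V)` via `f*` and `deg(f)⁻¹ f₊`
(Kahn 2020 Lemma 6.30 (2)). [cite: Kahn2020, §6.9 Lemma 6.30 (2)] -/
theorem standardConjectureC_of_pullback_top_ne_zero (hV : IsSmoothProjective N V)
    (hU : IsSmoothProjective N U) (f : V ⟶ U) (hf : W.pullback f (2 * N) ≠ 0)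
    (hC : W.StandardConjectureC N V) : W.StandardConjectureC N U :=
  W.standardConjectureC_iff.mpr fun _ ↦
    W.isAlgebraicOperator_id_of_pullback_top_ne_zero hV hU f hf (W.standardConjectureC_iff.mp hC _)

end Descent

end WeilCohomology

end Literature.AlgebraicGeometry.Motives

end
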